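import Summits.QuantumFields.BalabanUV.T4Continuum.Support.SmallFieldDomainsMetric

/-!
# T⁴ programme, SUBSTRATE — `Support/SmallFieldDomainsMetricBounds`: the `ℓ¹` comparisons of the multiscale distance `d_Ω` under the TRUNCATED
# scale hypotheses `∀ j ≤ k, …` and the geometric-scale sandwich `(cL^k)⁻¹·ℓ¹ ≤ d_Ω ≤ c⁻¹·ℓ¹` (the located usability repair
# R-ne9leaf08g11-1 ≡ R-ne9leaf05g15-1 of `Support/SmallFieldDomainsMetric`, journal l.15089 ∕ l.15029)

Audit cell `pub-balaban`, SUBSTRATE cell seat p4; same namespace as `Support/SmallFieldDomainsMetric` (`layerWeight`, `msDistΩ`, `mul_l1_le_msDist`,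
`msDist_le_mul_l1`), whose v1 hypotheses `∀ j, s j ≤ S` ∕ `∀ j, m ≤ s j` are UNSATISFIABLE at untruncated geometric scales `s j = L^j` (two independent
XREAD probes); since the point index never exceeds `k` (`ptIndex_le`), only the scales `s j`, `j ≤ k`, are ever charged, and the truncated forms below
are the usable ones.  (Filed as its own module: `…Metric` is at the 400-line limit; nothing there is changed.)
WHAT THIS FILE PROVIDES (all `[folklore]`): `inv_le_layerWeight_of_le` ∕ `mul_l1_le_msDistΩ_of_le` (`∀ j ≤ k, s j ≤ S` ⇒ `S⁻¹·ℓ¹ ≤ d_Ω`),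
`layerWeight_le_of_le` ∕ `msDistΩ_le_mul_l1_of_le` (`∀ j ≤ k, m ≤ s j` ⇒ `d_Ω ≤ m⁻¹·ℓ¹`), and `msDistΩ_geometric_sandwich` (`s j = c·L^j`, `1 ≤ L`:
`(c·L^k)⁻¹·ℓ¹(x,y) ≤ d_Ω(x,y) ≤ c⁻¹·ℓ¹(x,y)`).
HONEST FRAMING (T4-DAG p. 1).  Metric bookkeeping on `ℤ^d`; no configuration, no estimate of any NE row; spine 0/9 unchanged; NOT infinite volume, NOT a
mass gap, NOT Clay.  HONEST DEPENDENCY: continuum YM on T⁴ ⇐ BetaPertH ∧ nine spine estimates (0/9 proved); BetaPertH ⇐ (D1) ∧ (D4) ∧ CAP+tail; G-an2-4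
gates asym, D1 and NE2/3/4.  No `sorry`.
-/

noncomputable section

namespace Summit.QuantumFields.BalabanUV.T4Continuum.SmallFieldDomains

open Literature.MathematicalPhysics.QuantumFieldTheory.Balaban1983to89.B14DomainGeom
open Literature.MathematicalPhysics.QuantumFieldTheory.Balaban1983to89.B7Prop1Explicit (l1)

variable {d : ℕ}

/-! ## Truncated scale hypotheses: only the scales `s j`, `j ≤ k`, are ever charged -/

section Truncated
variable (s : ℕ → ℝ) (k : ℕ) (Ω : ℕ → Set (Pt d))

/-- XREAD R-ne9leaf08g11-1 ≡ R-ne9leaf05g15-1 (usability repair of `SmallFieldDomainsMetric.inv_le_layerWeight`): the point index never exceeds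
`k` (`ptIndex_le`), so the TRUNCATED hypothesis `∀ j ≤ k, s j ≤ S` — satisfiable at geometric scales with `S = c·L^k`, unlike `∀ j, s j ≤ S` —
already gives `S⁻¹ ≤ layerWeight s k Ω a b`. [folklore] -/
theorem inv_le_layerWeight_of_le (hs : ∀ j, 0 < s j) {S : ℝ} (hS : ∀ j ≤ k, s j ≤ S) (a b : Pt d) :
    S⁻¹ ≤ layerWeight s k Ω a b := by
  unfold layerWeight
  have h1 : S⁻¹ ≤ (s (ptIndex k Ω a))⁻¹ := inv_anti₀ (hs _) (hS _ (ptIndex_le k Ω a))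
  have h2 : S⁻¹ ≤ (s (ptIndex k Ω b))⁻¹ := inv_anti₀ (hs _) (hS _ (ptIndex_le k Ω b))
  linarith

/-- The LOWER `ℓ¹` comparison under the truncated hypothesis: `S⁻¹ · ℓ¹(x, y) ≤ d_Ω(x, y)` whenever `s j ≤ S` for `j ≤ k` (`S > 0`). [folklore] -/
theorem mul_l1_le_msDistΩ_of_le (hs : ∀ j, 0 < s j) {S : ℝ} (hS0 : 0 < S) (hS : ∀ j ≤ k, s j ≤ S) (x y : Pt d) :
    S⁻¹ * (l1 (y - x) : ℝ) ≤ msDistΩ s k Ω x y :=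
  mul_l1_le_msDist (inv_nonneg.mpr hS0.le) (fun a b _ => inv_le_layerWeight_of_le s k Ω hs hS a b) x y

/-- Likewise the uniform UPPER weight bound under the truncated hypothesis `∀ j ≤ k, m ≤ s j` (`m > 0`). [folklore] -/
theorem layerWeight_le_of_le {m : ℝ} (hm : 0 < m) (hms : ∀ j ≤ k, m ≤ s j) (a b : Pt d) :
    layerWeight s k Ω a b ≤ m⁻¹ := by
  unfold layerWeight
  have h1 : (s (ptIndex k Ω a))⁻¹ ≤ m⁻¹ := inv_anti₀ hm (hms _ (ptIndex_le k Ω a))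
  have h2 : (s (ptIndex k Ω b))⁻¹ ≤ m⁻¹ := inv_anti₀ hm (hms _ (ptIndex_le k Ω b))
  linarith

/-- The UPPER `ℓ¹` comparison under the truncated hypothesis: `d_Ω(x, y) ≤ m⁻¹ · ℓ¹(x, y)`. [folklore] -/
theorem msDistΩ_le_mul_l1_of_le (hs : ∀ j, 0 < s j) {m : ℝ} (hm : 0 < m) (hms : ∀ j ≤ k, m ≤ s j) (x y : Pt d) :
    msDistΩ s k Ω x y ≤ m⁻¹ * (l1 (y - x) : ℝ) :=
  msDist_le_mul_l1 (layerWeight_nonneg s k Ω hs) (layerWeight_le_of_le s k Ω hm hms) x y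

/-- **GEOMETRIC SCALES** `s j = c·L^j` (`c > 0`, `1 ≤ L`): the two-sided sandwich `(c·L^k)⁻¹ · ℓ¹(x, y) ≤ d_Ω(x, y) ≤ c⁻¹ · ℓ¹(x, y)` — the
instance the XREAD probes derived (`S = c·L^k`, `m = c`). [folklore] -/
theorem msDistΩ_geometric_sandwich {c Lr : ℝ} (hc : 0 < c) (hL : 1 ≤ Lr) (hsc : ∀ j, s j = c * Lr ^ j) (x y : Pt d) :
    (c * Lr ^ k)⁻¹ * (l1 (y - x) : ℝ) ≤ msDistΩ s k Ω x y ∧ msDistΩ s k Ω x y ≤ c⁻¹ * (l1 (y - x) : ℝ) := by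
  have hL0 : 0 < Lr := lt_of_lt_of_le one_pos hL
  have hs : ∀ j, 0 < s j := fun j => by rw [hsc j]; positivity
  refine ⟨mul_l1_le_msDistΩ_of_le s k Ω hs (by positivity) (fun j hj => ?_) x y,
    msDistΩ_le_mul_l1_of_le s k Ω hs hc (fun j _ => ?_) x y⟩
  · rw [hsc j]
    exact mul_le_mul_of_nonneg_left (pow_le_pow_right₀ hL hj) hc.le
  · rw [hsc j]
    have : (1 : ℝ) ≤ Lr ^ j := one_le_pow₀ hL
    nlinarith

end Truncated

end Summit.QuantumFields.BalabanUV.T4Continuum.SmallFieldDomains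

end
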